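import Literature.NumberTheory.Rogawski1990.ArchStableOrbitalWallEndStateReading   -- ★ p842254 (P1) (this seat): the per-`ρ` reading; brings ★ p842112, ★ p842078 (R1-h-c), ★ (R1-c)
import Literature.NumberTheory.Rogawski1990.ArchStableOrbitalWallEndStateSigned    -- (D3) (this seat): the algebraic signed end state over (D2-comb) ★ p842216 + (D2-eval)
import HarnessLib

/-!
# THE SIGNED END STATE OF THE «METHOD OF §8.2» ON ONE DIAGONAL CARRIER, MEASURE CURRENCY: `Σ_ρ (Π_v κ_v(ρ_v))·K⁻¹·∫ Θ d(⊗_v Wm_v(ρ_v)) = (Π_v (−2M_v)) · Φ^st_∞(t z⁰, (e_∞∘⟦·⟧)·Θ∘coe)`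
# ((R1-h-d) (D4) = (P1) ★ p842254 per `ρ` + (D3); Rogawski 1990 §8.2 p. 124, §14.5 pp. 238–239, §4.1 (4.1.2))

Topic `NumberTheory/Rogawski1990`; namespace `Literature.NumberTheory.Rogawski1990`.  THEOREMS ONLY (no `def`, no instance, no notation, no axiom, no named fact, no `sorry`).
Cell `pub/hodgecm-mathlib`, ENGINE T1 (crux H413 = `stmt-HodgeConjecture-24833`); floor-2 road «(J-nc) in-house», brick (D4) of (R1-h-d) (LEAD F0P3a-plan (g9) WORD T8-119∕T8-120);
author F0P3a-p07 (g8), 2026-09-01.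

WHAT.  The side-`α` sum of ★-to-be (D0-3) `wallCoef_sum_prod_mul_eq_of_regular_eq_of_clause` — TOKEN FOR TOKEN — read as an explicit multiple of the SIGNED archimedean stable
orbital integral of the (ST-∞) conjunct at the wall torus point `t(z⁰)`:
**`sum_prod_wallCoef_mul_integral_pi_wallFactor_eq_prod_mul_archStableOrbitalIntegral`**.  Hypotheses: ★ p841776's side-`α` wall data (`νw z₁ νH ντ`, `hντ`), the centraliser
measures `ρZ_v σ` on `G_v(α)` transported from the reference measures at the noncompact walls (`hρZ`, ★ p842112's convention), the wall constants `c v τ` (DATA, as in the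
clause-threaded chain ★ p842139 → (D0-2) → (D0-3)) evaluated by ONE noncompact constant `−M_v` (`hC`; ★ p842259 `const_eq_of_wallLinks` + the VALUE (J-val)) and ONE compact mass
`M_v = ρZ_v σ (Z)` (`hM`) per place, ★ (R1-c)'s telescope `ρP hρP ρ′ hρ′` at EVERY `t(z⁰∘ρ)` and the Weil form `hq` of the family `m` there (R2 point-Weil ★ p840955).  Proof = (D3)
`sum_prod_wallCoef_mul_eq_prod_mul_archStableOrbitalIntegral` with `I ρ := ∫ Θ d(⊗ Wm(ρ))` and `hI ρ :=` ★ p842254 (P1).  The two-carrier conclusion of (R1-h-d) is then (D0-3) read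
on each side by this theorem (one carrier explicit at a time — ★ p841776's elaboration rule).
HONEST LABEL: HC_CM is proved only modulo the 7 printed citations until rung 0 closes; this file is assembly of ★ bricks and pays nothing by itself.

## References
* [Rogawski1990] J. D. Rogawski, *Automorphic Representations of Unitary Groups in Three Variables*, Ann. of Math. Stud. 123 (1990), §8.2 pp. 122–124, §14.5 pp. 238–239, §4.1 (4.1.2).
* [Folland1995] G. B. Folland, *A Course in Abstract Harmonic Analysis* (1995), §2.6 (2.52).
* [DeitmarEchterhoff2014] A. Deitmar, S. Echterhoff, *Principles of Harmonic Analysis*, 2nd ed. (2014), Thm. 1.5.3.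
-/

set_option autoImplicit false

noncomputable section

open MeasureTheory Measure Filter Topology NumberField NumberField.InfinitePlace NumberField.mixedEmbedding Equiv Function Set
open Literature.MeasureTheory.Group Literature.NumberTheory.Automorphic Literature.NumberTheory.Automorphic.UnitaryGroup
open Literature.LinearAlgebra.Matrix
open scoped Matrix MatrixGroups Matrix.Norms.Operator ContDiff NNReal ENNReal

namespace Literature.NumberTheory.Rogawski1990

variable (L : Type) [Field L] [NumberField L] [IsCMField L] (α : Fin 3 → L)
  [MeasurableSpace (GL (Fin 3) ℂ)] [BorelSpace (GL (Fin 3) ℂ)]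
  [MeasurableSpace (arch (↥(maximalRealSubfield L)) L (IsCMField.complexConj L) 3 (Matrix.diagonal α))] [BorelSpace (arch (↥(maximalRealSubfield L)) L (IsCMField.complexConj L) 3 (Matrix.diagonal α))]
  [∀ γ' : arch (↥(maximalRealSubfield L)) L (IsCMField.complexConj L) 3 (Matrix.diagonal α),
    MeasurableSpace (arch (↥(maximalRealSubfield L)) L (IsCMField.complexConj L) 3 (Matrix.diagonal α) ⧸ Subgroup.centralizer ({γ'} : Set _))]
  [∀ γ' : arch (↥(maximalRealSubfield L)) L (IsCMField.complexConj L) 3 (Matrix.diagonal α),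
    BorelSpace (arch (↥(maximalRealSubfield L)) L (IsCMField.complexConj L) 3 (Matrix.diagonal α) ⧸ Subgroup.centralizer ({γ'} : Set _))]
  [∀ (v : {w : InfinitePlace L // IsComplex w}) (g : archLocal L 3 (Matrix.diagonal α) v),
    MeasurableSpace (archLocal L 3 (Matrix.diagonal α) v ⧸ Subgroup.centralizer ({g} : Set (archLocal L 3 (Matrix.diagonal α) v)))]
  [∀ (v : {w : InfinitePlace L // IsComplex w}) (g : archLocal L 3 (Matrix.diagonal α) v),
    BorelSpace (archLocal L 3 (Matrix.diagonal α) v ⧸ Subgroup.centralizer ({g} : Set (archLocal L 3 (Matrix.diagonal α) v)))]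

open scoped Classical in
/-- **(R1-h-d) THE SIGNED END STATE ON ONE DIAGONAL CARRIER, IN MEASURE CURRENCY.**  `Σ_ρ (Π_v κ_v(ρ_v))·(K_α⁻¹·∫ Θ ↑↑(e⁻¹ o) d(⊗_v Wm_v(ρ_v))) = (Π_v (−2·M_v)) · Φ^st_∞(t z⁰, e_∞·(Θ∘coe); m)`
— print's «equal to a non-zero constant times `Φ^st(γ₀, f)`» with the constant EXPLICIT.  See the module docstring for the hypotheses.
[cite: Rogawski1990, §8.2 p. 124; §14.5 pp. 238–239; §4.1 (4.1.2) p. 39] [cite: Folland1995, §2.6 (2.52)] [cite: DeitmarEchterhoff2014, Thm. 1.5.3] -/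
theorem sum_prod_wallCoef_mul_integral_pi_wallFactor_eq_prod_mul_archStableOrbitalIntegral
    (hα : ∀ i, α i ≠ 0) (hherm : ∀ i, (IsCMField.complexConj L (α i) : L) = α i)
    (z0 : {w : InfinitePlace L // IsComplex w} → Fin 3 → Circle) (hwall : ∀ v, z0 v 0 = z0 v 2 ∧ z0 v 0 ≠ z0 v 1)
    (νw : ∀ v : {w : InfinitePlace L // IsComplex w}, Measure (archLocal L 3 (Matrix.diagonal α) v)) (hνw : ∀ v, (νw v).IsHaarMeasure ∧ (νw v).IsMulRightInvariant)
    (z₁ : {w : InfinitePlace L // IsComplex w} → Fin 3 → Circle) (h02 : ∀ v, z₁ v 0 = z₁ v 2) (h01 : ∀ v, z₁ v 0 ≠ z₁ v 1)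
    [∀ (v : {w : InfinitePlace L // IsComplex w}) (τ : Perm (Fin 3)), MeasurableSpace (archLocal L 3 (Matrix.diagonal (α ∘ ⇑τ)) v ⧸ Subgroup.centralizer
      ({(⟨circleDiagonal 3 (z₁ v), circleDiagonal_mem_archLocal_diagonal L 3 (α ∘ ⇑τ) v (z₁ v)⟩ : archLocal L 3 (Matrix.diagonal (α ∘ ⇑τ)) v)} :
        Set (archLocal L 3 (Matrix.diagonal (α ∘ ⇑τ)) v)))]
    [∀ (v : {w : InfinitePlace L // IsComplex w}) (τ : Perm (Fin 3)), BorelSpace (archLocal L 3 (Matrix.diagonal (α ∘ ⇑τ)) v ⧸ Subgroup.centralizer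
      ({(⟨circleDiagonal 3 (z₁ v), circleDiagonal_mem_archLocal_diagonal L 3 (α ∘ ⇑τ) v (z₁ v)⟩ : archLocal L 3 (Matrix.diagonal (α ∘ ⇑τ)) v)} :
        Set (archLocal L 3 (Matrix.diagonal (α ∘ ⇑τ)) v)))]
    (νH : ∀ (v : {w : InfinitePlace L // IsComplex w}) (τ : Perm (Fin 3)), Measure (Subgroup.centralizer
      ({(⟨circleDiagonal 3 (z₁ v), circleDiagonal_mem_archLocal_diagonal L 3 (α ∘ ⇑τ) v (z₁ v)⟩ : archLocal L 3 (Matrix.diagonal (α ∘ ⇑τ)) v)} :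
        Set (archLocal L 3 (Matrix.diagonal (α ∘ ⇑τ)) v))))
    (hνH : ∀ v τ, (νH v τ).IsHaarMeasure ∧ (νH v τ).IsInvInvariant)
    (ντ : ∀ (v : {w : InfinitePlace L // IsComplex w}) (τ : Perm (Fin 3)), Measure (archLocal L 3 (Matrix.diagonal (α ∘ ⇑τ)) v))
    (hντi : ∀ v τ, (ντ v τ).IsHaarMeasure ∧ (ντ v τ).IsMulRightInvariant)
    (hντ : ντ = fun v τ => (νw v).map (ContinuousMulEquiv.restrictSubgroup (GLn.conjEquiv (Matrix.GeneralLinearGroup.mkOfDetNeZero _ (det_monomial_one_ne_zero 3 τ)))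
              (archLocal L 3 (Matrix.diagonal (α ∘ ⇑τ)) v) (archLocal L 3 (Matrix.diagonal α) v)
              (mem_archLocal_comp_perm_iff_conj_mem L 3 α v τ)).symm)
    -- centraliser measures on `G_v(α)` at the relabelled wall points, transported from the reference measures at the NONCOMPACT walls
    (ρZ : ∀ (v : {w : InfinitePlace L // IsComplex w}) (σ : Perm (Fin 3)), Measure (Subgroup.centralizer
      ({(⟨circleDiagonal 3 (z0 v ∘ ⇑σ), circleDiagonal_mem_archLocal_diagonal L 3 α v (z0 v ∘ ⇑σ)⟩ : archLocal L 3 (Matrix.diagonal α) v)} : Set (archLocal L 3 (Matrix.diagonal α) v))))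
    (hρZi : ∀ v σ, (ρZ v σ).IsHaarMeasure ∧ (ρZ v σ).IsInvInvariant)
    (hρZ : ∀ (v : {w : InfinitePlace L // IsComplex w}) (σ : Perm (Fin 3)), ¬ 0 < (v.1.embedding (α (σ⁻¹ 0))).re * (v.1.embedding (α (σ⁻¹ 2))).re →
      ρZ v σ = (νH v σ⁻¹).map (subgroupCongrHomeomorph (ContinuousMulEquiv.restrictSubgroup (GLn.conjEquiv (Matrix.GeneralLinearGroup.mkOfDetNeZero _ (det_monomial_one_ne_zero 3 σ⁻¹)))
        (archLocal L 3 (Matrix.diagonal (α ∘ ⇑σ⁻¹)) v) (archLocal L 3 (Matrix.diagonal α) v) (mem_archLocal_comp_perm_iff_conj_mem L 3 α v σ⁻¹)).toMulEquiv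
        (Subgroup.centralizer ({(⟨circleDiagonal 3 (z₁ v), circleDiagonal_mem_archLocal_diagonal L 3 (α ∘ ⇑σ⁻¹) v (z₁ v)⟩ : archLocal L 3 (Matrix.diagonal (α ∘ ⇑σ⁻¹)) v)} : Set (archLocal L 3 (Matrix.diagonal (α ∘ ⇑σ⁻¹)) v)))
        (Subgroup.centralizer ({(⟨circleDiagonal 3 (z0 v ∘ ⇑σ), circleDiagonal_mem_archLocal_diagonal L 3 α v (z0 v ∘ ⇑σ)⟩ : archLocal L 3 (Matrix.diagonal α) v)} : Set (archLocal L 3 (Matrix.diagonal α) v)))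
        (relabel_inv_mem_centralizer_circleDiagonal_comp_iff L α v σ (h02 v) (h01 v) (hwall v).1 (hwall v).2)
        (ContinuousMulEquiv.restrictSubgroup (GLn.conjEquiv (Matrix.GeneralLinearGroup.mkOfDetNeZero _ (det_monomial_one_ne_zero 3 σ⁻¹)))
          (archLocal L 3 (Matrix.diagonal (α ∘ ⇑σ⁻¹)) v) (archLocal L 3 (Matrix.diagonal α) v) (mem_archLocal_comp_perm_iff_conj_mem L 3 α v σ⁻¹)).continuous
        (ContinuousMulEquiv.restrictSubgroup (GLn.conjEquiv (Matrix.GeneralLinearGroup.mkOfDetNeZero _ (det_monomial_one_ne_zero 3 σ⁻¹)))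
          (archLocal L 3 (Matrix.diagonal (α ∘ ⇑σ⁻¹)) v) (archLocal L 3 (Matrix.diagonal α) v) (mem_archLocal_comp_perm_iff_conj_mem L 3 α v σ⁻¹)).symm.continuous))
    (Θ : Matrix (Fin 3) (Fin 3) (mixedSpace L) → ℂ) (hΘ : Continuous Θ)
    -- the wall constants (DATA) with their evaluation: one noncompact constant `−M_v` and one compact mass `M_v` per place
    (c : {w : InfinitePlace L // IsComplex w} → Perm (Fin 3) → ℂ) (M : {w : InfinitePlace L // IsComplex w} → ℝ)
    (hC : ∀ (v : {w : InfinitePlace L // IsComplex w}) (σ : Perm (Fin 3)),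
      ¬ 0 < (v.1.embedding (α (σ⁻¹ 0))).re * (v.1.embedding (α (σ⁻¹ 2))).re → c v σ⁻¹ = -(M v : ℂ))
    (hM : ∀ (v : {w : InfinitePlace L // IsComplex w}) (σ : Perm (Fin 3)),
      0 < (v.1.embedding (α (σ⁻¹ 0))).re * (v.1.embedding (α (σ⁻¹ 2))).re → ((ρZ v σ) Set.univ).toReal = M v)
    -- ★ (R1-c)'s telescope at EVERY point `t(z⁰ ∘ ρ)`, and the Weil form of `m` there
    [∀ ρ : {w : InfinitePlace L // IsComplex w} → Perm (Fin 3), MeasurableSpace ((∀ w : {w : InfinitePlace L // IsComplex w}, archLocal L 3 (Matrix.diagonal α) w) ⧸ Subgroup.pi Set.univ (fun w =>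
      Subgroup.centralizer ({(⟨circleDiagonal 3 (z0 w ∘ ⇑(ρ w)), circleDiagonal_mem_archLocal_diagonal L 3 α w (z0 w ∘ ⇑(ρ w))⟩ : archLocal L 3 (Matrix.diagonal α) w)} : Set _)))]
    [∀ ρ : {w : InfinitePlace L // IsComplex w} → Perm (Fin 3), BorelSpace ((∀ w : {w : InfinitePlace L // IsComplex w}, archLocal L 3 (Matrix.diagonal α) w) ⧸ Subgroup.pi Set.univ (fun w =>
      Subgroup.centralizer ({(⟨circleDiagonal 3 (z0 w ∘ ⇑(ρ w)), circleDiagonal_mem_archLocal_diagonal L 3 α w (z0 w ∘ ⇑(ρ w))⟩ : archLocal L 3 (Matrix.diagonal α) w)} : Set _)))]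
    (ρP : ∀ ρ : {w : InfinitePlace L // IsComplex w} → Perm (Fin 3), Measure (Subgroup.pi Set.univ (fun w : {w : InfinitePlace L // IsComplex w} => Subgroup.centralizer
      ({(⟨circleDiagonal 3 (z0 w ∘ ⇑(ρ w)), circleDiagonal_mem_archLocal_diagonal L 3 α w (z0 w ∘ ⇑(ρ w))⟩ : archLocal L 3 (Matrix.diagonal α) w)} : Set _))))
    (hρPi : ∀ ρ, (ρP ρ).IsHaarMeasure ∧ (ρP ρ).IsInvInvariant)
    (hρP : ∀ ρ : {w : InfinitePlace L // IsComplex w} → Perm (Fin 3), Measure.map (subgroupPiCoords fun w : {w : InfinitePlace L // IsComplex w} => Subgroup.centralizer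
      ({(⟨circleDiagonal 3 (z0 w ∘ ⇑(ρ w)), circleDiagonal_mem_archLocal_diagonal L 3 α w (z0 w ∘ ⇑(ρ w))⟩ : archLocal L 3 (Matrix.diagonal α) w)} : Set _)) (ρP ρ) =
        Measure.pi fun w => ρZ w (ρ w))
    [((Measure.pi νw).map (archPiEquivCM 3 L (Matrix.diagonal α)).symm).IsHaarMeasure]
    [((Measure.pi νw).map (archPiEquivCM 3 L (Matrix.diagonal α)).symm).IsMulRightInvariant]
    (m : OrbitalMeasureFamily (arch (↥(maximalRealSubfield L)) L (IsCMField.complexConj L) 3 (Matrix.diagonal α)))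
    [∀ q : ConjClasses (arch (↥(maximalRealSubfield L)) L (IsCMField.complexConj L) 3 (Matrix.diagonal α)),
      SMulInvariantMeasure (arch (↥(maximalRealSubfield L)) L (IsCMField.complexConj L) 3 (Matrix.diagonal α))
      (arch (↥(maximalRealSubfield L)) L (IsCMField.complexConj L) 3 (Matrix.diagonal α) ⧸
        Subgroup.centralizer ({(Quotient.out q : arch (↥(maximalRealSubfield L)) L (IsCMField.complexConj L) 3 (Matrix.diagonal α))} : Set _)) (m q)]
    (ρ' : ∀ ρ : {w : InfinitePlace L // IsComplex w} → Perm (Fin 3),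
      Measure (Subgroup.centralizer ({archDiagTorus L 3 α fun w => z0 w ∘ ⇑(ρ w)} : Set (arch (↥(maximalRealSubfield L)) L (IsCMField.complexConj L) 3 (Matrix.diagonal α)))))
    (hρ'i : ∀ ρ, (ρ' ρ).IsHaarMeasure ∧ (ρ' ρ).IsInvInvariant)
    (hρ' : ∀ ρ : {w : InfinitePlace L // IsComplex w} → Perm (Fin 3), ρ' ρ = (ρP ρ).map (subgroupCongrHomeomorph (archPiEquivCM 3 L (Matrix.diagonal α)).symm.toMulEquiv
      (Subgroup.pi Set.univ (fun w : {w : InfinitePlace L // IsComplex w} => Subgroup.centralizer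
        ({(⟨circleDiagonal 3 (z0 w ∘ ⇑(ρ w)), circleDiagonal_mem_archLocal_diagonal L 3 α w (z0 w ∘ ⇑(ρ w))⟩ : archLocal L 3 (Matrix.diagonal α) w)} : Set _)))
      (Subgroup.centralizer ({archDiagTorus L 3 α fun w => z0 w ∘ ⇑(ρ w)} : Set _))
      (apply_mem_centralizer_iff_mem_pi_centralizer _ (archPiEquivCM 3 L (Matrix.diagonal α)).symm.toMulEquiv
        (archPiEquivCM_symm_circleDiagonal_eq_archDiagTorus L 3 α fun w => z0 w ∘ ⇑(ρ w)))
      (archPiEquivCM 3 L (Matrix.diagonal α)).symm.continuous (archPiEquivCM 3 L (Matrix.diagonal α)).continuous))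
    (hq : ∀ ρ : {w : InfinitePlace L // IsComplex w} → Perm (Fin 3),
      haveI : ∀ w : {w : InfinitePlace L // IsComplex w}, LocallyCompactSpace (archLocal L 3 (Matrix.diagonal α) w) := fun w => locallyCompactSpace_archLocal L 3 (Matrix.diagonal α) w
      haveI : ∀ w : {w : InfinitePlace L // IsComplex w}, SecondCountableTopology (archLocal L 3 (Matrix.diagonal α) w) := fun w => secondCountableTopology_archLocal L 3 (Matrix.diagonal α) w
      haveI : (ρ' ρ).IsHaarMeasure := (hρ'i ρ).1
      haveI : (ρ' ρ).IsInvInvariant := (hρ'i ρ).2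
      m.atPoint (archDiagTorus L 3 α fun w => z0 w ∘ ⇑(ρ w)) =
        quotientMeasure (Subgroup.centralizer ({archDiagTorus L 3 α fun w => z0 w ∘ ⇑(ρ w)} : Set _)) (ρ' ρ) (isClosed_coe_centralizer_singleton _)
          ((Measure.pi νw).map (archPiEquivCM 3 L (Matrix.diagonal α)).symm)) :
    haveI : ∀ (v : {w : InfinitePlace L // IsComplex w}) (τ : Perm (Fin 3)), LocallyCompactSpace (archLocal L 3 (Matrix.diagonal (α ∘ ⇑τ)) v) := fun v τ => locallyCompactSpace_archLocal L 3 (Matrix.diagonal (α ∘ ⇑τ)) v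
    haveI : ∀ (v : {w : InfinitePlace L // IsComplex w}) (τ : Perm (Fin 3)), SecondCountableTopology (archLocal L 3 (Matrix.diagonal (α ∘ ⇑τ)) v) := fun v τ => secondCountableTopology_archLocal L 3 (Matrix.diagonal (α ∘ ⇑τ)) v
    haveI : ∀ v : {w : InfinitePlace L // IsComplex w}, LocallyCompactSpace (archLocal L 3 (Matrix.diagonal α) v) := fun v => locallyCompactSpace_archLocal L 3 (Matrix.diagonal α) v
    haveI : ∀ v : {w : InfinitePlace L // IsComplex w}, SecondCountableTopology (archLocal L 3 (Matrix.diagonal α) v) := fun v => secondCountableTopology_archLocal L 3 (Matrix.diagonal α) v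
    haveI : ∀ (v : {w : InfinitePlace L // IsComplex w}) (τ : Perm (Fin 3)), (νH v τ).IsHaarMeasure := fun v τ => (hνH v τ).1
    haveI : ∀ (v : {w : InfinitePlace L // IsComplex w}) (τ : Perm (Fin 3)), (νH v τ).IsInvInvariant := fun v τ => (hνH v τ).2
    haveI : ∀ (v : {w : InfinitePlace L // IsComplex w}) (τ : Perm (Fin 3)), (ντ v τ).IsHaarMeasure := fun v τ => (hντi v τ).1
    haveI : ∀ (v : {w : InfinitePlace L // IsComplex w}) (τ : Perm (Fin 3)), (ντ v τ).IsMulRightInvariant := fun v τ => (hντi v τ).2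
    ∑ ρ : {w : InfinitePlace L // IsComplex w} → Perm (Fin 3),
        (∏ v, (if 0 < (v.1.embedding (α ((ρ v)⁻¹ 0))).re * (v.1.embedding (α ((ρ v)⁻¹ 2))).re then (2 : ℂ) else c v (ρ v)⁻¹)) *
          ((((∏ v : {w : InfinitePlace L // IsComplex w},
            (Finset.univ.filter fun i => 0 < (v.1.embedding (α i)).re).card.factorial *
              (3 - (Finset.univ.filter fun i => 0 < (v.1.embedding (α i)).re).card).factorial : ℕ) : ℂ)⁻¹ *
            ∫ o, Θ ((((archPiEquivCM 3 L (Matrix.diagonal α)).symm o : arch (↥(maximalRealSubfield L)) L (IsCMField.complexConj L) 3 (Matrix.diagonal α)) : GL (Fin 3) (mixedSpace L)) : Matrix (Fin 3) (Fin 3) (mixedSpace L)) ∂(Measure.pi (fun v : {w : InfinitePlace L // IsComplex w} =>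
              (if 0 < (v.1.embedding (α ((ρ v)⁻¹ 0))).re * (v.1.embedding (α ((ρ v)⁻¹ 2))).re then (νw v).map fun y : archLocal L 3 (Matrix.diagonal α) v => y * (⟨circleDiagonal 3 (z0 v ∘ ⇑(ρ v)), circleDiagonal_mem_archLocal_diagonal L 3 α v (z0 v ∘ ⇑(ρ v))⟩ : archLocal L 3 (Matrix.diagonal α) v) * y⁻¹
              else ((quotientMeasure _ (νH v (ρ v)⁻¹) (isClosed_coe_centralizer_singleton _) (ντ v (ρ v)⁻¹)).map
                (descConj (⟨circleDiagonal 3 (z0 v), circleDiagonal_mem_archLocal_diagonal L 3 (α ∘ ⇑(ρ v)⁻¹) v (z0 v)⟩ : archLocal L 3 (Matrix.diagonal (α ∘ ⇑(ρ v)⁻¹)) v)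
                  (Subgroup.centralizer ({(⟨circleDiagonal 3 (z₁ v), circleDiagonal_mem_archLocal_diagonal L 3 (α ∘ ⇑(ρ v)⁻¹) v (z₁ v)⟩ :
                    archLocal L 3 (Matrix.diagonal (α ∘ ⇑(ρ v)⁻¹)) v)} : Set (archLocal L 3 (Matrix.diagonal (α ∘ ⇑(ρ v)⁻¹)) v)))
                  (forall_mem_centralizer_circleDiagonal_comm_of_wall L (α ∘ ⇑(ρ v)⁻¹) v (h02 v) (h01 v) (hwall v).1 (hwall v).2) id)).map
                (ContinuousMulEquiv.restrictSubgroup (GLn.conjEquiv (Matrix.GeneralLinearGroup.mkOfDetNeZero _ (det_monomial_one_ne_zero 3 (ρ v)⁻¹)))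
              (archLocal L 3 (Matrix.diagonal (α ∘ ⇑(ρ v)⁻¹)) v) (archLocal L 3 (Matrix.diagonal α) v)
              (mem_archLocal_comp_perm_iff_conj_mem L 3 α v (ρ v)⁻¹))))))) =
      (∏ v : {w : InfinitePlace L // IsComplex w}, (-(2 : ℂ) * M v)) *
        archStableOrbitalIntegral L 3 (Matrix.diagonal α) m
          (fun x => kottwitzSignArchWeight L 3 (Matrix.diagonal α) (ConjClasses.mk x) *
            Θ ((x : GL (Fin 3) (mixedSpace L)) : Matrix (Fin 3) (Fin 3) (mixedSpace L))) (archDiagTorus L 3 α z0) := by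
  classical
  have hreal : ∀ (v : {w : InfinitePlace L // IsComplex w}) (i : Fin 3), (v.1.embedding (α i)).im = 0 := fun v i => im_embedding_eq_zero_of_complexConj_eq L v (hherm i)
  refine sum_prod_wallCoef_mul_eq_prod_mul_archStableOrbitalIntegral L α hα hherm z0 hwall c (fun v σ => ((ρZ v σ) Set.univ).toNNReal) M hC
    (fun v σ hσ => hM v σ hσ) m _ _ fun ρ => ?_
  -- the per-`ρ` reading (★ p842254 (P1)) at the `ρ`-th telescope
  haveI : (ρP ρ).IsHaarMeasure := (hρPi ρ).1
  haveI : (ρP ρ).IsInvInvariant := (hρPi ρ).2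
  haveI : (ρ' ρ).IsHaarMeasure := (hρ'i ρ).1
  haveI : (ρ' ρ).IsInvInvariant := (hρ'i ρ).2
  exact integral_pi_wallFactor_eq_prod_smul_classOrbitalIntegral L α hα hherm z0 hwall νw hνw z₁ h02 h01 νH hνH ντ hντi hντ ρZ hρZi hρZ Θ hΘ ρ
    (ρP ρ) (hρP ρ) m (ρ' ρ) (hρ' ρ) (hq ρ)

end Literature.NumberTheory.Rogawski1990

end
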